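import Summits.QuantumFields.YangMills.Theorems.FluctuationComparisonRegPrIntLRunpairOrganDischargeInputsHJDefs
import Summits.QuantumFields.YangMills.Theorems.FluctuationComparisonRegPrIntLRunpairOrganFibreLawJDefs
import Summits.QuantumFields.YangMills.Theorems.FluctuationComparisonRegPrIntLOrganTangentJV0OfWindowDisplacement
import Summits.QuantumFields.YangMills.Theorems.FluctuationComparisonRegPrIntLOrganTangentCovSandwich
import Summits.QuantumFields.YangMills.Theorems.FluctuationComparisonRegPrIntLOrganTangentJTOfCurvatureTransport
import Summits.QuantumFields.YangMills.Theorems.FluctuationComparisonRegPrIntLOrganTangentLawClausesOfILaw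
import Summits.QuantumFields.YangMills.Theorems.FluctuationComparisonRegPrIntLOrganTangentLawJClausesOfILaw
import Summits.QuantumFields.YangMills.Theorems.FluctuationComparisonRegPrIntLOrganTangentFibreWeightNormalisation
import Summits.QuantumFields.YangMills.Theorems.FluctuationComparisonRegPrIntLOrganTangentILawKnitFacts
import Literature.MathematicalPhysics.QuantumFieldTheory.Balaban1983to89.T3PrintedMinimiserExistence
import Summits.QuantumFields.YangMills.Theorems.FluctuationComparisonRegPrIntLOrganTangentMultiWindowWeight
import HarnessLib

/-!
# The organ discharge knit: `OrganDischargeInputsHJ` ⟹ `SpreadFibreLawHJ`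

WHAT.  For the two reviewed hypothesis rows of the organ-tangent programme on the deciding crux `FluctuationComparisonRegPrIntL` (stmt-QuantumFields-20520,
line `Lines/runpair_organ.lean`): the «discharge inputs» row `OrganDischargeInputsHJ` (✓`…RunpairOrganDischargeInputsHJDefs`, edition «b», FROZEN by ★★OWNER RULING №78 ∕
WORD №416) IMPLIES the Jensen-edition spread fibre law `SpreadFibreLawHJ` (✓p814004 `…RunpairOrganFibreLawJDefs`).  The row is HJ's prefix and chart conjuncts [0]–[11] verbatim
followed by four INPUT groups — (I-geo) (`c Dw Db DP`: one-bond displacement `hdisp`, window-to-window `hglobW`, room), and under [12]'s seed binders (I-curv) (curvature-transport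
kernels `kP gP KP KP2`, per-`t` tail letters `kB ES` with good sets), (I-law) (per-`t` law-response blocks `kX kL` with (Lip)∕(Diff₀)∕score kernels along relational law paths;
`t`-uniform `kV₃ kV₄` packages) and (I-cov) (covariance-sandwich profiles) — so the proof is a KNIT: the prefix and [0]–[11] pass through, and each of HJ's nine remaining
conjuncts is ONE application of a landed door:
* (JT-h) — ✓p816525 `jtBracket_of_curvatureTransport` on (I-geo) + (I-curv);
* (L1ʲ-h), (L2ʲ-h) — ✓p817463 `l1j_of_ilaw` ∕ `l2j_of_ilaw` on (I-law), with the knit-side path facts of ✓p818026 `hpath_l1j_of_frame` ∕ `hsqpath_l2j_of_frame`;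
* (JV0-h) — ✓p816800 `jv0Clause_of_windowDisplacement` on (I-geo)'s `Dw` clause;
* (JV1-h), (JV2-h) — ✓p816302 `jv1∕jv2Clause_of_covKernel_profiles` on (I-cov);
* (JV3-h′), (JV4-h′) — ✓p817560 `jv3_of_ilaw` ∕ `jv4_of_ilaw` on (I-law), with ✓p818026 `hpath_jv3_of_frame` ∕ `hsqpath_jv4_of_frame`.
Frame facts (positivity∕continuity∕measurability of the level-`Ts` densities, the multi-window weight's letters) come from the row's own prefix exactly as in the Jensen knit
✓p814161; `0 ≤ wNum` is ✓`wNum_nonneg`; the `θ_j∕4`-law-window form of `hglob` consumed by ✓p816800∕✓p816525 is the special case of the row's `hglobW` by `plaqSmall_of_le`;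
the window guard `(1 + 16·√3·rc)·(θ_j∕4) ≤ θ_j` is ✓`hrc_of_sqrt3_mul_le` of the row's head smallness `√3·rc ≤ 3∕16`.

HONEST (★★OWNER RULING №77 (5), LEAD №38).  This file proves «ROW ⟹ HJ» and NOTHING about the row: `OrganDischargeInputsHJ` is a HYPOTHESIS text, exactly as open as
`SpreadFibreLawHJ`; its letters ((I-geo)'s `hglobW` in far-pair form — dischargeable only via a continuous small-link frame lemma (new) or the near-pair «sq» edition of the
currency, w4 g24 TN-HGLOB-FRAME —, `DP KP KP2`, (Lip)(Diff₀), score∕covariance kernels, profiles) are the discharger's burden from print.  Nothing of Bałaban's is asserted or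
proved here; `SpreadFibreLawH(J)` is NOT discharged; the registered stubs of `Lines/semiclassical_s2beta.lean`, stmt-20520 and `YM3TorusSU2` are NOT proved.  Rung R3 =
SU(2) YM₃ on T³ at fixed lattice data — NOT d = 4, NOT infinite volume, NOT a mass gap, NOT Clay.  [folklore] bookkeeping over hypothesis texts.
-/

set_option autoImplicit false

noncomputable section

namespace Summit.QuantumFields.YangMills.Theorems.OrganTangentSpreadFibreLawHJOfDischargeInputs

open MeasureTheory Filter Topology Function
open scoped ENNReal NNReal BigOperators
open Literature.MathematicalPhysics.QuantumFieldTheory.Balaban1983to89 T3ContinuumYM3Torus T3NestedUnitLaws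
  T3UnitLawDensityEML T4Continuum BalabanUVClass T3UnitScaleTilt T3LevelShift T3TiltDescent
open T4CubeChartExp (expPt)
open Summit.QuantumFields.YangMills.Theorems.FluctuationComparisonRegPrIntLRunpairOrganFibreLaw (mwCut wNum wgt)
open Summit.QuantumFields.YangMills.Theorems.FluctuationComparisonRegPrIntLRunpairOrganFibreLawJ (SpreadFibreLawHJ)
open Summit.QuantumFields.YangMills.Theorems.FluctuationComparisonRegPrIntLRunpairOrganDischargeInputsHJ (OrganDischargeInputsHJ)
open Summit.QuantumFields.YangMills.Theorems.FluctuationComparisonRegPrIntLOrganTangentMultiWindowWeight (exists_height_multiWindowWeight)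
open Summit.QuantumFields.YangMills.Theorems.OrganTangentJV0OfWindowDisplacement (jv0Clause_of_windowDisplacement)
open Summit.QuantumFields.YangMills.Theorems.OrganTangentCovSandwich (jv1Clause_of_covKernel_profiles jv2Clause_of_covKernel_profiles)
open Summit.QuantumFields.YangMills.Theorems.OrganTangentJTOfCurvatureTransport (jtBracket_of_curvatureTransport)
open Summit.QuantumFields.YangMills.Theorems.OrganTangentLawClausesOfILaw (l1j_of_ilaw l2j_of_ilaw)
open Summit.QuantumFields.YangMills.Theorems.OrganTangentLawJClausesOfILaw (jv3_of_ilaw jv4_of_ilaw)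
open Summit.QuantumFields.YangMills.Theorems.OrganTangentFibreWeightNormalisation (wNum_nonneg)
open T3PrintedMinimiserExistence (plaqSmall_of_le)
open Summit.QuantumFields.YangMills.Theorems.OrganTangentILawKnitFacts (hstabW_of_hglobW hrc_of_sqrt3_mul_le hpath_l1j_of_frame hsqpath_l2j_of_frame hpath_jv3_of_frame hsqpath_jv4_of_frame)
open Set (Icc)

/-- ★★★ **THE ORGAN DISCHARGE KNIT**: `OrganDischargeInputsHJ → SpreadFibreLawHJ` — prefix and chart [0]–[11] pass through; (JT-h) by ✓p816525, (L1ʲ-h)(L2ʲ-h) by ✓p817463 +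
✓p818026, (JV0-h) by ✓p816800, (JV1-h)(JV2-h) by ✓p816302, (JV3-h′)(JV4-h′) by ✓p817560 + ✓p818026 (module docstring).  A junction over hypothesis texts: it discharges
nothing of the row. [folklore] -/
theorem spreadFibreLawHJ_of_dischargeInputs (hD : OrganDischargeInputsHJ) : SpreadFibreLawHJ := by
  classical
  unfold SpreadFibreLawHJ
  obtain ⟨pW, γ₁, hγ₁, hD⟩ := hD
  refine ⟨pW, min γ₁ 1, lt_min hγ₁ one_pos, ?_⟩
  intro F γ hγ hγ1 b₀ p₀ j₀ prm η rA Bρ hb₀ hp₀ hpW hadm hη0 hηs hηss hηt hrA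
  have hγone : γ ≤ 1 := hγ1.trans (min_le_right _ _)
  obtain ⟨κ₀, hκ₀, hD⟩ := hD F γ hγ (hγ1.trans (min_le_left _ _)) b₀ p₀ j₀ prm η rA Bρ hb₀ hp₀ hpW hadm hη0 hηs hηss hηt hrA
  refine ⟨κ₀, hκ₀, ?_⟩
  intro κ hκ hκle
  obtain ⟨rc, w₀, NT, NX, NL, CJ, NV1, NV2, NV3, NV4, δT, δX, δL, δV1, δV2, δV3, δV4, j₁, hrc, hw₀, hNT, hNX, hNL, hCJ,
    hδ0, hδTs, hδTss, hδTt, hδXs, hδXss, hδXt, hδLs, hδLss, hδLt, hVfacts, hj₁, hD⟩ := hD κ hκ hκle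
  obtain ⟨jA, hMWA⟩ := exists_height_multiWindowWeight F γ b₀ p₀ hγ hγone hb₀
  refine ⟨rc, w₀, NT, NX, NL, CJ, NV1, NV2, NV3, NV4, δT, δX, δL, δV1, δV2, δV3, δV4, max j₁ jA, hrc, hw₀, hNT, hNX, hNL, hCJ,
    hδ0, hδTs, hδTss, hδTt, hδXs, hδXss, hδXt, hδLs, hδLss, hδLt, hVfacts, hj₁.trans (le_max_left _ _), ?_⟩
  intro ν hG hCν K K' hKK' Ts T hTs hTK μ μ' ρ ρ' hanch hcut hcons hfin hwin j hj hjTs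
  have hj1 : j₁ ≤ j := (le_max_left _ _).trans hj
  have hjA : jA ≤ j := (le_max_right _ _).trans hj
  obtain ⟨Z, instZ, τ, Φ, J, S, π, hτ, hΦm, hJm, hSm, hS, hsec, hdis, hcont, hJle, hpos, hπ1, hπ2, hgeo, hseedgrp⟩ :=
    hD ν hG hCν K K' hKK' Ts T hTs hTK μ μ' ρ ρ' hanch hcut hcons hfin hwin j hj1 hjTs
  obtain ⟨c, Dw, Db, DP, hrc16, hc, hDb0, hDPle, hdisp, hglobW, hroom⟩ := hgeo
  have hrc34 : Real.sqrt 3 * rc ≤ 3 / 4 := by linarith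
  -- frame facts
  have hθj : 0 < θBal F.L γ b₀ p₀ j := T3MinimiserStabilityReduction.θBal_pos F.hL.2.le hγ hγone hb₀ p₀ j
  have hθT : 0 < θBal F.L γ b₀ p₀ Ts := T3MinimiserStabilityReduction.θBal_pos F.hL.2.le hγ hγone hb₀ p₀ Ts
  have hθ4 : 0 < θBal F.L γ b₀ p₀ j / 4 := by positivity
  have hTs₀ : j₀ ≤ Ts := by omega
  have hTsT : Ts ≤ T := hTs.le
  have hposT : ∀ U, PlaqSmall (θBal F.L γ b₀ p₀ Ts) U → 0 < ρ Ts U ∧ 0 < ρ' Ts U := fun U hU => (hwin Ts hTs₀ hTsT).1 U hU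
  have hcT : ContinuousOn (ρ Ts) {U | PlaqSmall (θBal F.L γ b₀ p₀ Ts) U} := (hwin Ts hTs₀ hTsT).2.2.2.2.2.2.2.1.1
  have hcT' : ContinuousOn (ρ' Ts) {U | PlaqSmall (θBal F.L γ b₀ p₀ Ts) U} := (hwin Ts hTs₀ hTsT).2.2.2.2.2.2.2.1.2
  have hmeasT : ∀ (f : GaugeField (F.P Ts) 0 ↥(Matrix.specialUnitaryGroup (Fin 2) ℂ) → ℝ),
      (∃ κ' : ℝ, MemAtHeight F ℰp Ts (prm Ts) (fun U => Real.exp κ' * f U)) → Measurable f := by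
    intro f ⟨κ', hκ'⟩
    have hm1 : Measurable (fun U => Real.exp κ' * f U) := hκ'.measurable
    have hm2 : f = fun U => (Real.exp κ')⁻¹ * (Real.exp κ' * f U) := by
      funext U; rw [← mul_assoc, inv_mul_cancel₀ (Real.exp_pos κ').ne', one_mul]
    rw [hm2]; exact hm1.const_mul _
  have hρm : Measurable (ρ Ts) := hmeasT _ (hwin Ts hTs₀ hTsT).2.2.2.1
  have hρ'm : Measurable (ρ' Ts) := hmeasT _ (hwin Ts hTs₀ hTsT).2.2.2.2.1
  obtain ⟨hχc, hχ0, hχsupp, hχpos⟩ := hMWA j hjA Ts hjTs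
  haveI := hτ
  have hroomw : 24 / 25 * θBal F.L γ b₀ p₀ Ts + Dw ≤ c * θBal F.L γ b₀ p₀ Ts := by
    have : 0 ≤ (Db + Db) * rc := mul_nonneg (add_nonneg hDb0 hDb0) hrc.le
    linarith
  -- (T1): the old `θ_j∕4`-law-window clause is the special case of the widened one
  have hglob : ∀ (z : Z) (U U' : GaugeField (F.P j) 0 ↥(Matrix.specialUnitaryGroup (Fin 2) ℂ)), PlaqSmall (θBal F.L γ b₀ p₀ j / 4) U → PlaqSmall (θBal F.L γ b₀ p₀ j / 4) U' →
      ∀ p, dist1 (GaugeField.plaqHol (Φ (U', z)) p) ≤ dist1 (GaugeField.plaqHol (Φ (U, z)) p) + Dw :=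
    fun z U U' hU hU' => hglobW z U U' (plaqSmall_of_le (by linarith [hθj.le]) hU) hU'
  -- knit-side facts for the (I-law) dock
  have hw0 : ∀ (t : ℝ) (V : GaugeField (F.P j) 0 ↥(Matrix.specialUnitaryGroup (Fin 2) ℂ)) (z : Z), 0 ≤ wNum F γ b₀ p₀ j Ts ρ ρ' Φ J t V z :=
    wNum_nonneg F γ b₀ p₀ j Ts hjTs ρ ρ' hposT hθT hχ0 hχsupp Φ J
  have hΦV : ∀ V : GaugeField (F.P j) 0 ↥(Matrix.specialUnitaryGroup (Fin 2) ℂ), Measurable fun z : Z => Φ (V, z) := fun V => hΦm.comp (measurable_const.prodMk measurable_id)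
  have hmF : ∀ V : GaugeField (F.P j) 0 ↥(Matrix.specialUnitaryGroup (Fin 2) ℂ), AEStronglyMeasurable (fun z => Real.log (ρ Ts (Φ (V, z))) - Real.log (ρ' Ts (Φ (V, z)))) τ :=
    fun V => ((Real.measurable_log.comp (hρm.comp (hΦV V))).sub (Real.measurable_log.comp (hρ'm.comp (hΦV V)))).aestronglyMeasurable
  have hmW : ∀ (t : ℝ) (V : GaugeField (F.P j) 0 ↥(Matrix.specialUnitaryGroup (Fin 2) ℂ)), AEStronglyMeasurable (fun z => wNum F γ b₀ p₀ j Ts ρ ρ' Φ J t V z) τ := by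
    intro t V
    haveI : CompactSpace (GaugeField (F.P Ts) 0 ↥(Matrix.specialUnitaryGroup (Fin 2) ℂ)) :=
      inferInstanceAs (CompactSpace (PBond (F.P Ts) 0 → ↥(Matrix.specialUnitaryGroup (Fin 2) ℂ)))
    haveI : BorelSpace (GaugeField (F.P Ts) 0 ↥(Matrix.specialUnitaryGroup (Fin 2) ℂ)) :=
      Literature.MathematicalPhysics.QuantumFieldTheory.Balaban1983to89.T3OrbitAverage.instBorelSpaceGaugeField
    have hJm1 : Measurable fun z => (J (V, z) : ℝ) := (hJm.comp (measurable_const.prodMk measurable_id)).coe_nnreal_real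
    have h1 : Measurable fun z => mwCut F γ b₀ p₀ j Ts (Φ (V, z)) := hχc.measurable.comp (hΦV V)
    have h2 : Measurable fun z => Real.rpow (ρ Ts (Φ (V, z))) t * Real.rpow (ρ' Ts (Φ (V, z))) (1 - t) :=
      ((hρm.comp (hΦV V)).pow_const t).mul ((hρ'm.comp (hΦV V)).pow_const (1 - t))
    exact ((h1.mul h2).mul hJm1).aestronglyMeasurable
  -- PATH-FACTS = w5 g24's (L30) `…OrganTangentILawKnitFacts`: stability from the widened `Dw`-clause, then the four suppliers
  have hstabW := hstabW_of_hglobW F γ b₀ p₀ j Ts hjTs hχsupp Φ c Dw hroomw hglobW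
  have hwin : (1 + 16 * Real.sqrt 3 * rc) * (θBal F.L γ b₀ p₀ j / 4) ≤ θBal F.L γ b₀ p₀ j := hrc_of_sqrt3_mul_le hrc16 hθj.le
  have hPX := hpath_l1j_of_frame F γ b₀ p₀ j Ts hjTs ρ ρ' hρm hρ'm hcT hcT' hposT hθT hχc hχ0 hχsupp hχpos τ Φ J hΦm hJm CJ hJle hpos
    c hc rc hθj.le hwin hrc.le hstabW
  have hPV3 := hpath_jv3_of_frame F γ b₀ p₀ j Ts hjTs ρ ρ' hρm hρ'm hcT hcT' hposT hθT hχc hχ0 hχsupp hχpos τ Φ J hΦm hJm CJ hJle hpos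
    c hc rc hθj.le hwin hrc.le hstabW
  have hSL := hsqpath_l2j_of_frame F γ b₀ p₀ j Ts hjTs ρ ρ' hρm hρ'm hcT hcT' hposT hθT hχc hχ0 hχsupp hχpos τ Φ J hΦm hJm CJ hJle hpos
    c hc rc hθj.le hwin hstabW
  have hSV4 := hsqpath_jv4_of_frame F γ b₀ p₀ j Ts hjTs ρ ρ' hρm hρ'm hcT hcT' hposT hθT hχc hχ0 hχsupp hχpos τ Φ J hΦm hJm CJ hJle hpos
    c hc rc hθj.le hwin hstabW
  -- (JV0-h) from (I-geo)'s `Dw` clause (used by both blocks)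
  have hJV0 := jv0Clause_of_windowDisplacement F γ b₀ p₀ j Ts hjTs ρ ρ' hρm hρ'm hcT hcT' hposT hθT hθj hχc hχ0 hχsupp hχpos
    τ Φ J hΦm hJm CJ hJle hpos c Dw hc hroomw hglob
  refine ⟨Z, instZ, τ, Φ, J, S, π, hτ, hΦm, hJm, hSm, hS, hsec, hdis, hcont, hJle, hpos, hπ1, hπ2, ?_, ?_⟩
  · -- the (H) block
    intro k w hkw0 hwle hk0 hkrow hksq
    obtain ⟨⟨kP, gP, KP, KP2, hk, hg, hKP, hKP2, hcurvT⟩, hlawXL, -, -, -⟩ := hseedgrp k w hkw0 hwle hk0 hkrow hksq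
    refine ⟨?_, ?_, ?_⟩
    · -- (JT-h) ⟸ (I-geo) + (I-curv) by ✓p816525
      intro t ht0 ht1
      obtain ⟨kB, ES, hkB0, hES, hmass, hGoodAll⟩ := hcurvT t ht0 ht1
      refine ⟨fun B B' => (∑ p, ∑ q, KP p B * kP p q * KP q B' + ∑ p, gP p * KP2 p B B') + ES * kB B B', ?_, hmass, ?_⟩
      · intro B B'
        refine add_nonneg (add_nonneg (Finset.sum_nonneg fun p _ => Finset.sum_nonneg fun q _ => ?_) (Finset.sum_nonneg fun p _ => ?_))
          (mul_nonneg hES (hkB0 B B'))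
        · exact mul_nonneg (mul_nonneg (hKP p B) (hk p q)) (hKP q B')
        · exact mul_nonneg (hg p) (hKP2 p B B')
      · intro B B' m m' U V W Y Xw hm hm' hU hV hW hY hXw hVU hVb hWU hWb hYV hYb
        obtain ⟨Good, hGood, htail, hcurv, hcrude⟩ := hGoodAll Xw hXw
        exact jtBracket_of_curvatureTransport F γ b₀ p₀ j Ts hjTs ρ ρ' hρm hρ'm hcT hcT' hposT hθT hθj hχc hχ0 hχsupp hχpos
          τ Φ J hΦm hJm CJ hJle hpos t hrc34 hc DP hDb0 hDb0 hdisp hglob hroom B B' m m' U V W Y Xw hm hm' hU hV hW hY hXw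
          hVU hVb hWU hWb hYV hYb (fun p => hDPle p B) (fun p => hDPle p B') kP gP KP KP2 hk hg hKP hKP2 Good hGood hcurv
          (hkB0 B B') hES (hcrude B B' m m' U V W Y hm hm' hU hV hW hY hVU hVb hWU hWb hYV hYb) htail
    · -- (L1ʲ-h) ⟸ (I-law-X) by ✓p817463 `l1j_of_ilaw` + PATH-FACTS (X)
      intro t ht0 ht1
      obtain ⟨hX, -⟩ := hlawXL t ht0 ht1
      exact l1j_of_ilaw F γ b₀ p₀ j Ts ρ ρ' τ Φ J κ rc w NX δX t (hw0 t) hmF (hmW t) (hPX t) hX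
    · -- (L2ʲ-h) ⟸ (I-law-L) by ✓p817463 `l2j_of_ilaw` + PATH-FACTS (L)
      intro t ht0 ht1
      obtain ⟨-, hL⟩ := hlawXL t ht0 ht1
      exact l2j_of_ilaw F γ b₀ p₀ j Ts ρ ρ' τ Φ J κ rc w NL δL t (hw0 t) hmF (hmW t) (hSL t) hL
  · -- the (HV′) block
    intro k w hkw0 hwle hk0 hkrow hksq
    obtain ⟨-, -, hV3, hV4, Prof, 𝒢, ωf, NG, NG₀, K, ωX, Ncol, Nrow, K2, NY, x₀, hG0, hωf, hNG, hGrow, hNG₀, hGrow₀, hCov, hK0, hωX, hNrow, hKcol,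
      hKrow, htri, hProf1, hK20, hK2mass, hProf2, hx₀, hProf0, hM2, hM1⟩ := hseedgrp k w hkw0 hwle hk0 hkrow hksq
    have hLawN : ∀ t : ℝ, 0 ≤ t → t ≤ 1 → ∀ Xw : GaugeField (F.P j) 0 ↥(Matrix.specialUnitaryGroup (Fin 2) ℂ), PlaqSmall (θBal F.L γ b₀ p₀ j / 4) Xw →
        Integrable (fun z => (fun t Xw z => (wgt F γ b₀ p₀ j Ts ρ ρ' τ Φ J t) Xw z) t Xw z) τ
          ∧ ∫ z, (fun t Xw z => (wgt F γ b₀ p₀ j Ts ρ ρ' τ Φ J t) Xw z) t Xw z ∂τ = 1 :=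
      fun t ht0 ht1 Xw hXw => ⟨(hJV0 t ht0 ht1 Xw Xw hXw hXw).1, (hJV0 t ht0 ht1 Xw Xw hXw hXw).2.1⟩
    have hLawF : ∀ t : ℝ, 0 ≤ t → t ≤ 1 → ∀ X Xw : GaugeField (F.P j) 0 ↥(Matrix.specialUnitaryGroup (Fin 2) ℂ), PlaqSmall (θBal F.L γ b₀ p₀ j / 4) X → PlaqSmall (θBal F.L γ b₀ p₀ j / 4) Xw →
        Integrable (fun z => (fun X z => Real.log (ρ Ts (Φ (X, z))) - Real.log (ρ' Ts (Φ (X, z)))) X z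
          * (fun t Xw z => (wgt F γ b₀ p₀ j Ts ρ ρ' τ Φ J t) Xw z) t Xw z) τ :=
      fun t ht0 ht1 X Xw hX hXw => (hJV0 t ht0 ht1 X Xw hX hXw).2.2.1
    refine ⟨hJV0, ?_, ?_, ?_, ?_⟩
    · exact jv1Clause_of_covKernel_profiles τ (fun X z => Real.log (ρ Ts (Φ (X, z))) - Real.log (ρ' Ts (Φ (X, z))))
        (fun t Xw z => (wgt F γ b₀ p₀ j Ts ρ ρ' τ Φ J t) Xw z) (θBal F.L γ b₀ p₀ j / 4) rc κ (NV1 * ((((F.L : ℝ) ^ j / γ) * θBal F.L γ b₀ p₀ j ^ 2) / (((F.L : ℝ) ^ Ts / γ) * θBal F.L γ b₀ p₀ Ts ^ 2)) * w * (w / (((F.L : ℝ) ^ Ts / γ) * θBal F.L γ b₀ p₀ Ts ^ 2)) + δV1 j * (((F.L : ℝ) ^ j / γ) * θBal F.L γ b₀ p₀ j ^ 2)) hθ4 Prof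
        hLawN hLawF 𝒢 NG₀ hG0 hNG₀ hGrow₀ hCov K2 NY hK20 hK2mass hProf2 x₀ hx₀ hProf0 hM1
    · exact jv2Clause_of_covKernel_profiles τ (fun X z => Real.log (ρ Ts (Φ (X, z))) - Real.log (ρ' Ts (Φ (X, z))))
        (fun t Xw z => (wgt F γ b₀ p₀ j Ts ρ ρ' τ Φ J t) Xw z) (θBal F.L γ b₀ p₀ j / 4) rc κ (NV2 * ((((F.L : ℝ) ^ j / γ) * θBal F.L γ b₀ p₀ j ^ 2) / (((F.L : ℝ) ^ Ts / γ) * θBal F.L γ b₀ p₀ Ts ^ 2)) * w * (w / (((F.L : ℝ) ^ Ts / γ) * θBal F.L γ b₀ p₀ Ts ^ 2)) + δV2 j * (((F.L : ℝ) ^ j / γ) * θBal F.L γ b₀ p₀ j ^ 2)) hθ4 Prof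
        𝒢 ωf NG hG0 hωf hNG hGrow hCov K ωX Ncol Nrow hK0 hωX hNrow hKcol hKrow htri hProf1 hM2
    · -- (JV3-h′) ⟸ (I-law-V3) by ✓p817560 `jv3_of_ilaw` + PATH-FACTS (V3)
      exact jv3_of_ilaw F γ b₀ p₀ j Ts ρ ρ' τ Φ J κ rc w NV3 δV3 hw0 hmF hmW hPV3 hV3
    · -- (JV4-h′) ⟸ (I-law-V4) by ✓p817560 `jv4_of_ilaw` + PATH-FACTS (V4)
      exact jv4_of_ilaw F γ b₀ p₀ j Ts ρ ρ' τ Φ J κ rc w NV4 δV4 hw0 hmF hmW hSV4 hV4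

end Summit.QuantumFields.YangMills.Theorems.OrganTangentSpreadFibreLawHJOfDischargeInputs

end
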